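import Summits.ValiantsHypothesis.ValiantsHypothesis.Theorems.SymPencilPerFourPeeledElevenOfCoverage
import Summits.ValiantsHypothesis.ValiantsHypothesis.Theorems.SymPencilPerFourPeeledTwoPencilCoverage

/-!
# Route `SymPencil` — inner rank of the `2 | 2` row split of `per_4`: the PEELED case at eleven
# squares, `IR11`, and cell `(8,8,11)` of the `m = 28` table — UNCONDITIONAL (`--supports`
# stmt-ValiantsHypothesis-5674 `SdcSuperquadratic`; (8,8) column; memo
# `NOTE-p8g15-5674-R2-two-pencil.md` §9; rung currency only — nothing here bears on `VP ≠ VNP`)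

The three conditional theorems of `…PeeledElevenOfCoverage` (val-lit-p6 g17: frameless quadruple
`…TwoPencilFramelessFlip` (p8 g15) + corner `…CornerGenSwapFrameless` (p6 g16/g17), modulo the
coverage hypothesis `hcov`) discharged by ONE application each of the coverage theorem
`…TwoPencilCoverage.genSwap_of_frameless` (val-lit-p8 g16):

* `false_of_peeled_le_eleven` — no reduced peeled family of the `2 | 2` inner-rank identity of
  `per_4` lives on `≤ 11` squares;
* `HR2_eleven` — the binder `HR2` of `…InnerRankOfPeeled.IR_of_peeled` at `d = 11`;
* `IR11` — the `2 | 2` inner-rank identity `Σ_r c_r t_r(a,b;y₂,y₃)² = per(a,b,y₂,y₃)` has NO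
  solution with eleven bilinear forms `t_r` (characteristic `0`);
* `false_of_rank_eight_le_twentyEight` — in the base-point package of a symmetric affine
  determinantal representation of `per_4` of size `m ≤ 28`, the rank `dim im b_L = 8` is
  impossible: cell `(8, 8, 11)` of the `m = 28` table is EMPTY.

Honest framing: ONE cell — the inner-rank-`8` row — of the size-`28` table, nothing more: the
other rows of that table (`r = 9, …, 13`, landed for size `≤ 27` only) are NOT in the tree at size
`28`, and nothing about the determinantal complexity of `per_4` is claimed here.  The aside item
`SdcSuperquadratic` (super-quadratic growth in `n`) stays OPEN and `VP ≠ VNP` is not moved; no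
summit statement is proved.  Credit: engine/atlas/frameless cut (p8 g15), Case-A class, corners
and conditional assembly (p6 g16/g17), reader of record crit-5 g4; this file only composes.  No
definitions, no named facts. [folklore]
-/

noncomputable section

-- single-conjunct layout: Sub = Summit, duplicated namespace component intended
set_option linter.dupNamespace false

namespace Summit.ValiantsHypothesis.ValiantsHypothesis.Theorems.SymPencilPerFourPeeledEleven

open Matrix Finset Module MvPolynomial
open Literature.Computability.AlgebraicComplexity
open Summit.ValiantsHypothesis.ValiantsHypothesis.Theorems.SymPencilPerFourPeeledElevenOfCoverage
open Summit.ValiantsHypothesis.ValiantsHypothesis.Theorems.SymPencilPerFourPeeledTwoPencilCoverage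
open Summit.ValiantsHypothesis.ValiantsHypothesis.Theorems.SymPencilPerFourInnerRankOfPeeled

universe v

/-- ★ **No reduced peeled family on `≤ 11` squares.** [folklore] -/
theorem false_of_peeled_le_eleven {K : Type*} [Field K] [CharZero K]
    {κ : Type v} [Fintype κ] [DecidableEq κ] (hκ : Fintype.card κ ≤ 11) (c : κ → K)
    (hc : ∀ r, c r ≠ 0)
    (t : κ → (((Fin 4 → K) × (Fin 4 → K)) →ₗ[K] ((Fin 4 → K) × (Fin 4 → K)) →ₗ[K] K))
    (hJ : ∀ a b y₂ y₃ : Fin 4 → K,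
      ∑ r, c r * (t r (a, b) (y₂, y₃)) ^ 2 = (Matrix.of ![a, b, y₂, y₃]).permanent)
    (v₀ v₀' : κ → K) (hv₀ : ∀ (a x : Fin 4 → K), ∃ s : K, (fun r => t r (a, 0) (x, 0)) = s • v₀)
    (hv₀' : ∀ (b x : Fin 4 → K), ∃ s : K, (fun r => t r (0, b) (0, x)) = s • v₀')
    (hpeel : ∃ a b y z : Fin 4 → K, ∑ r, c r * t r (a, 0) (y, 0) * t r (0, b) (0, z) ≠ 0) :
    False :=
  false_of_peeled_le_eleven_of_coverage (fun Ψ h₁ h₂ => genSwap_of_frameless Ψ h₁ h₂) hκ c hc t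
    hJ v₀ v₀' hv₀ hv₀' hpeel

/-- ★ **`HR2` at `d = 11`** (the binder of `…InnerRankOfPeeled.IR_of_peeled`), unconditional.
[folklore] -/
theorem HR2_eleven (K : Type*) [Field K] [CharZero K] :
    ∀ (κ : Type) [Fintype κ] [DecidableEq κ], Fintype.card κ ≤ 11 →
      ∀ (c : κ → K), (∀ r, c r ≠ 0) →
      ∀ (t : κ → (((Fin 4 → K) × (Fin 4 → K)) →ₗ[K] ((Fin 4 → K) × (Fin 4 → K)) →ₗ[K] K)),
      (∀ a b y₂ y₃ : Fin 4 → K,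
        ∑ r, c r * (t r (a, b) (y₂, y₃)) ^ 2 = (Matrix.of ![a, b, y₂, y₃]).permanent) →
      ∀ (v₀ v₀' : κ → K),
      (∀ (a x : Fin 4 → K), ∃ s : K, (fun r => t r (a, 0) (x, 0)) = s • v₀) →
      (∀ (b x : Fin 4 → K), ∃ s : K, (fun r => t r (0, b) (0, x)) = s • v₀') →
      (∀ a b y₂ y₃ : Fin 4 → K,
        ∑ r, c r * (t r (0, b) (y₂, 0) + t r (a, 0) (0, y₃)) ^ 2 =
          (Matrix.of ![a, b, y₂, y₃]).permanent
            - 2 * ∑ r, c r * t r (a, 0) (y₂, 0) * t r (0, b) (0, y₃)) →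
      (∃ a b y z : Fin 4 → K, ∑ r, c r * t r (a, 0) (y, 0) * t r (0, b) (0, z) ≠ 0) → False :=
  HR2_eleven_of_coverage K (fun Ψ h₁ h₂ => genSwap_of_frameless Ψ h₁ h₂)

/-- ★★ **IR11: the `2 | 2` inner-rank identity of `per_4` has no solution on eleven squares**
(characteristic `0`). [folklore] -/
theorem IR11 (K : Type*) [Field K] [CharZero K] :
    ∀ (c : Fin 11 → K)
      (t : Fin 11 → (((Fin 4 → K) × (Fin 4 → K)) →ₗ[K] ((Fin 4 → K) × (Fin 4 → K)) →ₗ[K] K)),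
      ¬ ∀ a b y₂ y₃ : Fin 4 → K,
        ∑ r, c r * (t r (a, b) (y₂, y₃)) ^ 2 = (Matrix.of ![a, b, y₂, y₃]).permanent :=
  IR11_of_coverage K (fun Ψ h₁ h₂ => genSwap_of_frameless Ψ h₁ h₂)

/-- ★★ **Cell `(8, 8, 11)` of the `m = 28` table is EMPTY**: in the base-point package of a
symmetric affine determinantal representation of `per_4` of size `m ≤ 28` over a field of
characteristic `0`, `dim im b_L ≠ 8`. [folklore] -/
theorem false_of_rank_eight_le_twentyEight (K : Type*) [Field K] [CharZero K]
    {m : ℕ} (hm : m ≤ 28)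
    {i₀ : Fin m} {D : Matrix {i // i ≠ i₀} {i // i ≠ i₀} K}
    {bL : (Fin 4 × Fin 4 → K) →ₗ[K] ({i // i ≠ i₀} → K)}
    {CL : (Fin 4 × Fin 4 → K) →ₗ[K] Matrix {i // i ≠ i₀} {i // i ≠ i₀} K} {κ₀ : K}
    (hD : IsUnit D.det) (hDs : Dᵀ = D) (hCs : ∀ z, (CL z)ᵀ = CL z) (hκ₀ : κ₀ ≠ 0)
    (hi : ∀ z, bL z ⬝ᵥ D⁻¹ *ᵥ bL z = 0)
    (hii : ∀ z, bL z ⬝ᵥ (D⁻¹ * CL z * D⁻¹) *ᵥ bL z = 0)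
    (hiii : ∀ z, D.det * (bL z ⬝ᵥ (D⁻¹ * CL z * D⁻¹ * CL z * D⁻¹) *ᵥ bL z) =
      -(κ₀ * eval z (perPoly (Fin 4) K)))
    (hV4 : ∀ x ∈ LinearMap.ker bL, ∀ r c : Fin 4,
      ((Matrix.of fun i j => x (i, j)).submatrix r.succAbove c.succAbove).permanent = 0)
    (hcard : Fintype.card {i // i ≠ i₀} + 1 = m)
    (hrn : finrank K (LinearMap.range bL) + finrank K (LinearMap.ker bL) = 16)
    (h8 : finrank K (LinearMap.range bL) = 8) : False :=
  false_of_rank_eight_le_twentyEight_of_coverage K (fun Ψ h₁ h₂ => genSwap_of_frameless Ψ h₁ h₂)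
    hm hD hDs hCs hκ₀ hi hii hiii hV4 hcard hrn h8

end Summit.ValiantsHypothesis.ValiantsHypothesis.Theorems.SymPencilPerFourPeeledEleven

end
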